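import Summits.ABC.StewartYu.PadicG3TwoSatPack
import Summits.ABC.StewartYu.PadicG3TwoSizes
import HarnessLib

/-!
# Cell abc-stewartyu, WP-L.P(2) (crux r4 `PadicCoreTwoRat`, stmt-ABC-20504), record interface: CLOSED-FORM SIZES of the slots of the
# schedule of record `schedTwoN` of the 𝔑-threaded frame (weights, Hasse sizes, virtual denominators, Siegel coefficient bound,
# Liouville constant of the k-steps)

`Summits/ABC/StewartYu/PadicG3TwoSizesN.lean` — cell `abc-stewartyu` (HOME `run/shared/lean/pub/abc-stewartyu/`), route
`YuMatveevShapeRat`, seat p3 (g10, WP-L.P(2) lead; memo-13 §1).  One abbreviating definition (`feldSizeN`, `hboxvN`) and theorems; no named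
fact.  Twin of p5's `PadicG3TwoSizes` on `schedTwoN S F P` (shared by the two open stubs `stub_gainTwoN` / `stub_smallTwoN` of line
`padic-two-sat-frame`): every abstract slot that enters the lines (L2₀)/(L2)/(L3) bounded by an explicit real in the letters of
`P : PadicG3Par (d+1)`, `N = F.N`, the depth `Istar3N`, the degree `L03N` and weights `Vo ≥ h(αo)` of the saturation datum:
* `Bw3N_le` / `Bw3N_pos` / `log_Bw3N_le`: `log Bw3N ≤ L03N·(m+3)·log 2`;
* `feldSizeN` / `M₀3N_le_two_mul` / `log_feldSizeN` / `log_M₀3N_le`: `log M₀3N I x τ ≤ log 2 + (I*N−I)·t·log 3 + t·log ν(H) + H/e +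
  L03N·(1 + log(1 + 3^{I*N−I}|x|/H))`;
* `log_M₀E3N_le`, `one_le_M₀E3N`; the VIRTUAL far-height unit `hboxvN I = Σⱼ (Bv3N I j/N)·Voⱼ` and `log_Dm_Bv3N_le`
  (`log Dm(Bv3N I, x) ≤ 2|x|·hboxvN I + 2ΣVo`, p3-g9's `SatData.log_Dm_le_of_weights`);
* `log_Amax3N_le`: `log Amax3N ≤ log M₀E3N + T03N 0·log Xb3N 0 + 4X·hboxvN 0 + 4ΣVo`;
* `log_cardBN_eq`, `log_P_schedTwoN_le`;
* **`log_KTwoSat_schedTwoN_le`**: `log KTwoSat I x τ ≤ log cardBN + (log cardBN + log Amax3N + log 2) + (log 2 + log feldSizeN I |x| τ.1)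
  + |t|·log Xb3N I + 4|x|·hboxvN I + 4ΣVo`.

WHAT THIS IS NOT: the third-step sizes (`thirdDenSat`/`thirdMSat`, sequel), the bounds of `hboxvN`, `Xb3N`, `cardBN` in `P`-letters
(sequel), the budget comparison; no crux moves (A1.L not moved).

References: Yu. V. Nesterenko, LNM 1819 (2003), §3.1 Prop 3.1, Lemma 3.11, §4.2 (4.19)–(4.35); K. Yu, Acta Math. 211 (2013), §3.1,
(5.35)–(5.41).
-/

noncomputable section

open Finset Real
open Literature.NumberTheory.Transcendental
open Literature.NumberTheory.Transcendental (FeldmanDelta.den)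
open Literature.NumberTheory.Transcendental.FeldmanDelta
open Literature.NumberTheory.Transcendental.CW77.Setup (Tau tauNorm)

namespace Summit.ABC.StewartYu

namespace TwoSetup

open Summit.ABC.StewartYu.G3Boxes

variable (S : TwoSetup) (F : S.SatData) (P : PadicG3Par (S.d + 1))

/-! ### The `2`-adic weight slot -/

/-- **`Bw3N ≤ (8·2^m)^{L03N}`.** [cite: Nesterenko2003, §3.1 (3.5)–(3.6); shape only] -/
theorem Bw3N_le : S.Bw3N F P ≤ (8 * (2 : ℝ) ^ P.m) ^ S.L03N F P := by
  have hH : 1 ≤ P.H := le_max_left _ _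
  unfold Bw3N
  refine Finset.sup'_le _ _ fun ℓ hℓ => ?_
  have hℓ' : ℓ ≤ S.L03N F P := by have := Finset.mem_range.mp hℓ; omega
  have h1 : ‖((den ℓ P.H : ℚ_[2]))⁻¹‖ ≤ (2 : ℝ) ^ ℓ := FeldmanDen.norm_inv_den_two_le ℓ hH
  have h8 : (1 : ℝ) ≤ 8 * (2 : ℝ) ^ P.m := by
    have : (1 : ℝ) ≤ (2 : ℝ) ^ P.m := one_le_pow₀ (by norm_num)
    linarith
  calc ‖((den ℓ P.H : ℚ_[2]))⁻¹‖ * (4 * (2 : ℝ) ^ P.m) ^ ℓ ≤ (2 : ℝ) ^ ℓ * (4 * (2 : ℝ) ^ P.m) ^ ℓ := by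
        gcongr
    _ = (8 * (2 : ℝ) ^ P.m) ^ ℓ := by rw [← mul_pow]; ring
    _ ≤ (8 * (2 : ℝ) ^ P.m) ^ S.L03N F P := pow_le_pow_right₀ h8 hℓ'

/-- `0 < Bw3N`. [folklore] -/
theorem Bw3N_pos : 0 < S.Bw3N F P := by
  have h := S.Bw3N_ge F P 0 (Nat.zero_le _)
  rw [pow_zero, mul_one] at h
  exact lt_of_lt_of_le (by rw [norm_pos_iff]; exact inv_ne_zero (by exact_mod_cast den_ne_zero 0 P.H)) h

/-- **`log Bw3N ≤ L03N·(m+3)·log 2`.** [cite: Nesterenko2003, §3.1 (3.5)–(3.6); shape only] -/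
theorem log_Bw3N_le : Real.log (S.Bw3N F P) ≤ S.L03N F P * ((P.m + 3) * Real.log 2) := by
  have h := Real.log_le_log (S.Bw3N_pos F P) (S.Bw3N_le F P)
  refine h.trans (le_of_eq ?_)
  rw [Real.log_pow, Real.log_mul (by norm_num) (by positivity), Real.log_pow,
    show (8 : ℝ) = 2 ^ 3 by norm_num, Real.log_pow]
  push_cast
  ring

/-! ### The Hasse sizes -/

/-- The real Fel'dman size at level `I`, point size `r`, order `t` of the 𝔑-threaded schedule:
`3^{(I*N−I)t}·ν(H)^t·e^{H/e}·(e(1+3^{I*N−I}r/H))^{L03N}`. [cite: Nesterenko2003, §3.1 Prop 3.1; shape only] -/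
def feldSizeN (I : ℕ) (r : ℝ) (t : ℕ) : ℝ :=
  (3 : ℝ) ^ ((S.Istar3N F P - I) * t) * ((Nat.lcmUpto P.H : ℝ) ^ t *
    (Real.exp (P.H / Real.exp 1) * (Real.exp 1 * (1 + (3 : ℝ) ^ (S.Istar3N F P - I) * r / P.H)) ^ S.L03N F P))

/-- `1 ≤ feldSizeN` for `r ≥ 0`. [folklore] -/
theorem one_le_feldSizeN (I : ℕ) {r : ℝ} (hr : 0 ≤ r) (t : ℕ) : 1 ≤ S.feldSizeN F P I r t := by
  unfold feldSizeN
  have h3 : (1 : ℝ) ≤ (3 : ℝ) ^ ((S.Istar3N F P - I) * t) := one_le_pow₀ (by norm_num)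
  have hν : (1 : ℝ) ≤ (Nat.lcmUpto P.H : ℝ) ^ t := one_le_pow₀ (by exact_mod_cast Nat.lcmUpto_pos P.H)
  have he : (1 : ℝ) ≤ Real.exp (P.H / Real.exp 1) := Real.one_le_exp (by positivity)
  have hb : (1 : ℝ) ≤ (Real.exp 1 * (1 + (3 : ℝ) ^ (S.Istar3N F P - I) * r / P.H)) ^ S.L03N F P := by
    refine one_le_pow₀ ?_
    have h1 : (1 : ℝ) ≤ Real.exp 1 := Real.one_le_exp zero_le_one
    have h2 : (0 : ℝ) ≤ (3 : ℝ) ^ (S.Istar3N F P - I) * r / P.H := by positivity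
    nlinarith
  calc (1 : ℝ) = 1 * (1 * (1 * 1)) := by ring
    _ ≤ _ := by gcongr

/-- `feldSizeN` is monotone in the point size and the order. [folklore] -/
theorem feldSizeN_mono (I : ℕ) {r r' : ℝ} (hr : 0 ≤ r) (hrr : r ≤ r') {t t' : ℕ} (htt : t ≤ t') :
    S.feldSizeN F P I r t ≤ S.feldSizeN F P I r' t' := by
  unfold feldSizeN
  have hν1 : (1 : ℝ) ≤ (Nat.lcmUpto P.H : ℝ) := by exact_mod_cast Nat.lcmUpto_pos P.H
  have he1 : (1 : ℝ) ≤ Real.exp 1 := Real.one_le_exp zero_le_one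
  gcongr
  norm_num

/-- **`M₀3N I x τ ≤ 2·feldSizeN I |x| τ.1`** (the ceiling costs a factor `≤ 2`). [folklore] -/
theorem M₀3N_le_two_mul (I : ℕ) (x : ℤ) (τ : Tau S.d) :
    (S.M₀3N F P I x τ : ℝ) ≤ 2 * S.feldSizeN F P I |(x : ℝ)| τ.1 := by
  have h1 := S.one_le_feldSizeN F P I (abs_nonneg (x : ℝ)) τ.1
  have hc : (S.M₀3N F P I x τ : ℝ) < S.feldSizeN F P I |(x : ℝ)| τ.1 + 1 := by
    unfold M₀3N feldSizeN
    exact Int.ceil_lt_add_one _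
  linarith

/-- `1 ≤ M₀3N I x τ`. [folklore] -/
theorem one_le_M₀3N (I : ℕ) (x : ℤ) (τ : Tau S.d) : (1 : ℝ) ≤ (S.M₀3N F P I x τ : ℝ) := by
  have h := S.M₀3N_ge F P I x τ 0 (Nat.zero_le _)
  rw [pow_zero, mul_one] at h
  refine le_trans ?_ h
  have h3 : (1 : ℝ) ≤ (3 : ℝ) ^ ((S.Istar3N F P - I) * τ.1) := one_le_pow₀ (by norm_num)
  have hν : (1 : ℝ) ≤ (Nat.lcmUpto P.H : ℝ) ^ τ.1 := one_le_pow₀ (by exact_mod_cast Nat.lcmUpto_pos P.H)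
  have he : (1 : ℝ) ≤ Real.exp (P.H / Real.exp 1) := Real.one_le_exp (by positivity)
  calc (1 : ℝ) = 1 * (1 * 1) := by ring
    _ ≤ _ := by gcongr

/-- **`log feldSizeN`** in closed form. [cite: Nesterenko2003, §3.1 (3.4)–(3.8); shape only] -/
theorem log_feldSizeN (I : ℕ) {r : ℝ} (hr : 0 ≤ r) (t : ℕ) :
    Real.log (S.feldSizeN F P I r t) = ((S.Istar3N F P - I) * t : ℕ) * Real.log 3 + t * Real.log (Nat.lcmUpto P.H) +
      P.H / Real.exp 1 + S.L03N F P * (1 + Real.log (1 + (3 : ℝ) ^ (S.Istar3N F P - I) * r / P.H)) := by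
  unfold feldSizeN
  have hν : (0 : ℝ) < (Nat.lcmUpto P.H : ℝ) := by exact_mod_cast Nat.lcmUpto_pos P.H
  have hy : (0 : ℝ) < 1 + (3 : ℝ) ^ (S.Istar3N F P - I) * r / P.H := by positivity
  rw [Real.log_mul (by positivity) (by positivity), Real.log_mul (by positivity) (by positivity),
    Real.log_mul (by positivity) (by positivity), Real.log_pow, Real.log_pow, Real.log_exp, Real.log_pow,
    Real.log_mul (by positivity) hy.ne', Real.log_exp]
  ring

/-- **`log M₀3N I x τ ≤ log 2 + log feldSizeN I r t`** for `|x| ≤ r`, `τ.1 ≤ t`. [folklore] -/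
theorem log_M₀3N_le (I : ℕ) {x : ℤ} {r : ℝ} (hx : |(x : ℝ)| ≤ r) {τ : Tau S.d} {t : ℕ} (ht : τ.1 ≤ t) :
    Real.log (S.M₀3N F P I x τ : ℝ) ≤ Real.log 2 + Real.log (S.feldSizeN F P I r t) := by
  have h1 := S.one_le_M₀3N F P I x τ
  have h2 := (S.M₀3N_le_two_mul F P I x τ).trans
    (mul_le_mul_of_nonneg_left (S.feldSizeN_mono F P I (abs_nonneg _) hx ht) (by norm_num))
  have hf := S.one_le_feldSizeN F P I ((abs_nonneg (x : ℝ)).trans hx) t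
  rw [← Real.log_mul (by norm_num) (by linarith)]
  exact Real.log_le_log (by linarith) h2

/-! ### The level-`0` Siegel sizes -/

/-- **`log M₀E3N ≤ log 2 + log feldSizeN 0 X (T03N 0)`.** [folklore] -/
theorem log_M₀E3N_le :
    Real.log (S.M₀E3N F P (S.one_le_T03N F P 0) : ℝ) ≤ Real.log 2 + Real.log (S.feldSizeN F P 0 P.X (S.T03N F P 0)) := by
  obtain ⟨e, he, heq'⟩ := Finset.exists_mem_eq_sup' (eqSet_nonempty S.d P.X (S.one_le_T03N F P 0))
    (fun e : ℤ × Tau S.d => S.M₀3N F P 0 e.1 e.2)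
  unfold M₀E3N
  rw [heq']
  have hm := mem_eqSet.mp he
  refine S.log_M₀3N_le F P 0 (by exact_mod_cast hm.1) ?_
  have : e.2.1 ≤ tauNorm e.2 := by unfold tauNorm; omega
  omega

/-- `1 ≤ M₀E3N`. [folklore] -/
theorem one_le_M₀E3N : (1 : ℝ) ≤ (S.M₀E3N F P (S.one_le_T03N F P 0) : ℝ) := by
  obtain ⟨e, he⟩ := eqSet_nonempty S.d P.X (S.one_le_T03N F P 0)
  have h := S.M₀3N_le_M₀E3N F P (S.one_le_T03N F P 0) he
  exact (S.one_le_M₀3N F P 0 e.1 e.2).trans (by exact_mod_cast h)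

/-! ### The virtual far-height unit and the virtual clearing denominator -/

/-- **The VIRTUAL far-height unit at level `I`**: `hboxvN I = Σⱼ (Bv3N I j/N)·Voⱼ` (weights `Vo ≥ h(αo)`). [folklore] -/
def hboxvN (Vo : Fin (S.d + 1) → ℝ) (I : ℕ) : ℝ := ∑ j, ((S.Bv3N F P I j : ℝ) / F.N) * Vo j

/-- `0 ≤ hboxvN` for nonnegative weights. [folklore] -/
theorem hboxvN_nonneg {Vo : Fin (S.d + 1) → ℝ} (hVo : ∀ j, 0 ≤ Vo j) (I : ℕ) : 0 ≤ S.hboxvN F P Vo I := by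
  unfold hboxvN
  exact Finset.sum_nonneg fun j _ => by have := hVo j; positivity

/-- **The virtual clearing denominator of the schedule**: `log Dm(Bv3N I, x) ≤ 2|x|·hboxvN I + 2ΣVo` for weights `h(αoⱼ) ≤ Voⱼ`.
[cite: Nesterenko2003, Lemma 3.11; shape only] -/
theorem log_Dm_Bv3N_le {Vo : Fin (S.d + 1) → ℝ} (hVo : ∀ j, Height.logHeight₁ (F.αo j) ≤ Vo j) (I : ℕ) (x : ℤ) :
    Real.log (F.Dm (S.Bv3N F P I) x : ℝ) ≤ 2 * |(x : ℝ)| * S.hboxvN F P Vo I + 2 * ∑ j, Vo j :=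
  F.log_Dm_le_of_weights (S.Bv3N F P I) x Vo hVo

/-- **`log Amax3N ≤ log M₀E3N + T03N 0·log Xb3N 0 + 4X·hboxvN 0 + 4ΣVo`.** [cite: Yu2013, (4.28); shape only] -/
theorem log_Amax3N_le {Vo : Fin (S.d + 1) → ℝ} (hVo : ∀ j, Height.logHeight₁ (F.αo j) ≤ Vo j) :
    Real.log (S.Amax3N F P (S.one_le_T03N F P 0)) ≤ Real.log (S.M₀E3N F P (S.one_le_T03N F P 0) : ℝ) +
      (S.T03N F P 0 : ℝ) * Real.log (S.Xb3N F P 0 : ℝ) + 4 * (P.X : ℝ) * S.hboxvN F P Vo 0 + 4 * ∑ j, Vo j := by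
  have hVo0 : ∀ j, 0 ≤ Vo j := fun j => (Height.zero_le_logHeight₁ _).trans (hVo j)
  have hM := S.one_le_M₀E3N F P
  have hXb1 : (1 : ℝ) ≤ (S.Xb3N F P 0 : ℝ) := by exact_mod_cast S.one_le_Xb3N F P 0
  have hh := S.hboxvN_nonneg F P hVo0 0
  have hsV : 0 ≤ ∑ j, Vo j := Finset.sum_nonneg fun j _ => hVo0 j
  have hR : 0 ≤ Real.log (S.M₀E3N F P (S.one_le_T03N F P 0) : ℝ) + (S.T03N F P 0 : ℝ) * Real.log (S.Xb3N F P 0 : ℝ) +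
      4 * (P.X : ℝ) * S.hboxvN F P Vo 0 + 4 * ∑ j, Vo j := by
    have := Real.log_nonneg hM; have := Real.log_nonneg hXb1; positivity
  unfold Amax3N
  rcases le_total ((eqSet S.d P.X (S.T03N F P 0)).sup' (eqSet_nonempty S.d P.X (S.one_le_T03N F P 0)) fun e =>
      (S.M₀E3N F P (S.one_le_T03N F P 0) : ℝ) * (S.Xb3N F P 0 : ℝ) ^ (∑ j, e.2.2 j) *
        ((F.Dm (S.Bv3N F P 0) e.1 : ℝ)) ^ 2) 1 with h1 | h1
  · rw [max_eq_left h1, Real.log_one]; exact hR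
  · rw [max_eq_right h1]
    obtain ⟨e, he, heq'⟩ := Finset.exists_mem_eq_sup' (eqSet_nonempty S.d P.X (S.one_le_T03N F P 0))
      (fun e : ℤ × Tau S.d => (S.M₀E3N F P (S.one_le_T03N F P 0) : ℝ) * (S.Xb3N F P 0 : ℝ) ^ (∑ j, e.2.2 j) *
        ((F.Dm (S.Bv3N F P 0) e.1 : ℝ)) ^ 2)
    rw [heq']
    have hm := mem_eqSet.mp he
    have hmon1 : (1 : ℝ) ≤ (F.Dm (S.Bv3N F P 0) e.1 : ℝ) := by exact_mod_cast F.one_le_Dm _ _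
    rw [Real.log_mul (by positivity) (by positivity), Real.log_mul (by positivity) (by positivity),
      Real.log_pow, Real.log_pow]
    have hsum : ((∑ j, e.2.2 j : ℕ) : ℝ) ≤ S.T03N F P 0 := by
      have : ∑ j, e.2.2 j ≤ tauNorm e.2 := by unfold tauNorm; omega
      exact_mod_cast (this.trans hm.2.le)
    have hlogmon := S.log_Dm_Bv3N_le F P hVo 0 e.1
    have hx : |(e.1 : ℝ)| ≤ P.X := by exact_mod_cast hm.1
    have h2 : 2 * |(e.1 : ℝ)| * S.hboxvN F P Vo 0 ≤ 2 * (P.X : ℝ) * S.hboxvN F P Vo 0 := by gcongr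
    have hXlog := Real.log_nonneg hXb1
    have ht : ((∑ j, e.2.2 j : ℕ) : ℝ) * Real.log (S.Xb3N F P 0 : ℝ) ≤ (S.T03N F P 0 : ℝ) * Real.log (S.Xb3N F P 0 : ℝ) :=
      mul_le_mul_of_nonneg_right hsum hXlog
    push_cast at ht ⊢
    linarith [hlogmon, h2, ht]

/-! ### The Liouville constant of the k-steps -/

/-- **`log cardBN = log(L03N+1) + d·log(2Dco+1) + log(2Dco+1)`.** [folklore] -/
theorem log_cardBN_eq :
    Real.log (S.cardBN F P : ℝ) = Real.log ((S.L03N F P + 1 : ℕ) : ℝ) +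
      ((S.d : ℝ) * Real.log ((2 * S.Dco F P + 1 : ℕ) : ℝ) + Real.log ((2 * S.Dco F P + 1 : ℕ) : ℝ)) := by
  unfold cardBN
  push_cast
  rw [Real.log_mul (by positivity) (by positivity), Real.log_mul (by positivity) (by positivity),
    Finset.prod_const, Finset.card_univ, Fintype.card_fin, Real.log_pow]

/-- `1 ≤ cardBN` (real). [folklore] -/
theorem one_le_cardBN_real : (1 : ℝ) ≤ (S.cardBN F P : ℝ) := by exact_mod_cast S.one_le_cardBN F P

/-- **`log P ≤ log cardBN + log Amax3N + log 2`** for the coefficient slot of the schedule. [folklore] -/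
theorem log_P_schedTwoN_le :
    Real.log ((S.schedTwoN F P).P : ℝ) ≤ Real.log (S.cardBN F P : ℝ) +
      Real.log (S.Amax3N F P (S.one_le_T03N F P 0)) + Real.log 2 := by
  rw [schedTwoN_P]
  set c : ℝ := (S.cardBN F P : ℝ) with hc
  set A : ℝ := S.Amax3N F P (S.one_le_T03N F P 0) with hA
  have hc1 : (1 : ℝ) ≤ c := S.one_le_cardBN_real F P
  have hA1 : (1 : ℝ) ≤ A := le_max_left _ _
  have hcA : (1 : ℝ) ≤ c * A := one_le_mul_of_one_le_of_one_le hc1 hA1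
  have hceil : ((⌈c * A⌉ : ℤ) : ℝ) ≤ 2 * (c * A) := by
    have := Int.ceil_lt_add_one (c * A); linarith
  have hpos : (0 : ℝ) < ((⌈c * A⌉ : ℤ) : ℝ) := by
    have : (1 : ℤ) ≤ ⌈c * A⌉ := Int.one_le_ceil_iff.mpr (by linarith)
    exact_mod_cast this
  rw [← Real.log_mul (by positivity) (by positivity), ← Real.log_mul (by positivity) (by norm_num)]
  exact Real.log_le_log hpos (by linarith)

/-- **`log KTwoSat` of the schedule of record, closed form**: for weights `h(αoⱼ) ≤ Voⱼ`,
`log KTwoSat I x τ ≤ log cardBN + (log cardBN + log Amax3N + log 2) + (log 2 + log feldSizeN I |x| τ.1) + |t|·log Xb3N I +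
4|x|·hboxvN I + 4ΣVo`. [cite: Nesterenko2003, §4.2 (4.24)–(4.35); shape only] [cite: Yu2013, (5.35)–(5.40); shape only] -/
theorem log_KTwoSat_schedTwoN_le {Vo : Fin (S.d + 1) → ℝ} (hVo : ∀ j, Height.logHeight₁ (F.αo j) ≤ Vo j)
    (I : ℕ) (x : ℤ) (τ : Tau S.d) :
    Real.log (KTwoSat (S.schedTwoN F P) F (S.Bv3N F P) I x τ) ≤
      Real.log (S.cardBN F P : ℝ) +
        (Real.log (S.cardBN F P : ℝ) + Real.log (S.Amax3N F P (S.one_le_T03N F P 0)) + Real.log 2) +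
        (Real.log 2 + Real.log (S.feldSizeN F P I |(x : ℝ)| τ.1)) +
        (∑ j, τ.2 j : ℕ) * Real.log (S.Xb3N F P I : ℝ) + (4 * |(x : ℝ)| * S.hboxvN F P Vo I + 4 * ∑ j, Vo j) := by
  unfold KTwoSat
  rw [schedTwoN_cardB, schedTwoN_M₀, schedTwoN_Xb]
  have hc : (0 : ℝ) < (S.cardBN F P : ℝ) := lt_of_lt_of_le one_pos (S.one_le_cardBN_real F P)
  have hP : (0 : ℝ) < ((S.schedTwoN F P).P : ℝ) := by exact_mod_cast S.one_le_P_schedTwoN F P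
  have hM : (0 : ℝ) < (S.M₀3N F P I x τ : ℝ) := S.M₀3N_pos F P I x τ
  have hXb : (0 : ℝ) < (S.Xb3N F P I : ℝ) := by
    exact_mod_cast (show (0 : ℤ) < S.Xb3N F P I by have := S.one_le_Xb3N F P I; omega)
  have hDm1 : (1 : ℝ) ≤ (F.Dm (S.Bv3N F P I) x : ℝ) := by exact_mod_cast F.one_le_Dm _ _
  have hDm : (0 : ℝ) < (F.Dm (S.Bv3N F P I) x : ℝ) := lt_of_lt_of_le one_pos hDm1
  rw [Real.log_mul (by positivity) (by positivity), Real.log_mul (by positivity) (by positivity),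
    Real.log_mul (by positivity) (by positivity), Real.log_mul (by positivity) (by positivity), Real.log_pow, Real.log_pow]
  have h1 := S.log_P_schedTwoN_le F P
  have h2 : Real.log (S.M₀3N F P I x τ : ℝ) ≤ Real.log 2 + Real.log (S.feldSizeN F P I |(x : ℝ)| τ.1) :=
    S.log_M₀3N_le F P I le_rfl le_rfl
  have h3 := S.log_Dm_Bv3N_le F P hVo I x
  push_cast
  linarith

end TwoSetup

end Summit.ABC.StewartYu

end
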